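import Summits.Ventures.PercRepro.RankLevelSetRuleQCornerChain

/-!
# PercRepro — THE TAIL IS SMALL FROM `q ≥ 8k`: THE CORNER OF EVERY FAMILY `k ≥ 10` FOR EVERY `q ≥ 8k`, UNIFORMLY IN `k`
(p4, gen 29; C-044; paper proofs/P4-CELL-THREE.md §13.12)

`tail = Σ_{k ≤ i < 2k} C(2k−1,i)·W_i(q, q+1−k) ≤ 4^{k−1}·W_k ≤ 16^h·W_{2h}` (`h = ⌊k/2⌋`, `W` antitone in its index), the
two-step bound iterated `Π_{i<h}(2q+2i+1)·W_{2h} ≤ Π_{i<h}(2i+1)·S` (`sumW_even_le`), `S(q,q+1−k)² ≤ q` (`sumS_corner_sq_le`),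
the pairing bound `(Π_{i<h}(2i+1))² ≤ h^{2h}` (`prod_odd_sq_le`: `(2i+1)(2h−1−2i) ≤ h²`) and `Π_{i<h}(2q+2i+1) ≥ (2q)^h`
reduce `tail ≤ q/(2q+k)` to the numeric inequality `256^h·(2q+k)²·h^{2h}·q ≤ (q·(2q)^h)²` (`numeric_core`), which holds for
`h ≥ 5`, `k ≤ 2h+1`, `8k ≤ q`, `16h ≤ q` since `(16h)² ≤ q²`, `8(2q+k) ≤ 17q` and `289h ≤ 4^{h+1}`.  With
RankLevelSetRuleQCornerChain's `rhat_corner_of_tail`: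
**`rhat_corner_of_eight_k (q k) (hk : 10 ≤ k) (hq : 8k ≤ q) : phiK (q+k) q ≤ rhat q k (q + 1 − k)`.**  Axioms standard.
-/

namespace PercRepro

open Finset

/-- `289·h ≤ 4^{h+1}` for `h ≥ 5`. -/
lemma two_eight_nine_le (h : ℕ) (hh : 5 ≤ h) : 289 * h ≤ 4 ^ (h + 1) := by
  induction h, hh using Nat.le_induction with
  | base => norm_num
  | succ n hn ih =>
    have h4 : 4 ^ (n + 1 + 1) = 4 * 4 ^ (n + 1) := by rw [pow_succ]; ring
    have h6 : 4 ^ 6 ≤ 4 ^ (n + 1) := Nat.pow_le_pow_right (by norm_num) (by omega)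
    norm_num at h6
    omega

/-- The pairing bound `(Π_{i<h}(2i+1))² ≤ (h²)^h` (`(2i+1)·(2(h−1−i)+1) ≤ h²`). -/
lemma prod_odd_sq_le (h : ℕ) : (∏ i ∈ range h, (2 * (i : ℚ) + 1)) ^ 2 ≤ ((h : ℚ) ^ 2) ^ h := by
  have hrefl : ∏ i ∈ range h, (2 * ((h - 1 - i : ℕ) : ℚ) + 1) = ∏ i ∈ range h, (2 * (i : ℚ) + 1) :=
    Finset.prod_range_reflect (fun i => 2 * (i : ℚ) + 1) h
  calc (∏ i ∈ range h, (2 * (i : ℚ) + 1)) ^ 2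
      = (∏ i ∈ range h, (2 * (i : ℚ) + 1)) * ∏ i ∈ range h, (2 * ((h - 1 - i : ℕ) : ℚ) + 1) := by
        rw [hrefl, sq]
    _ = ∏ i ∈ range h, ((2 * (i : ℚ) + 1) * (2 * ((h - 1 - i : ℕ) : ℚ) + 1)) := by
        rw [Finset.prod_mul_distrib]
    _ ≤ ∏ i ∈ range h, ((h : ℚ) ^ 2) := by
        apply Finset.prod_le_prod (fun i _ => by positivity)
        intro i hi
        rw [Finset.mem_range] at hi
        have hc : ((h - 1 - i : ℕ) : ℚ) = (h : ℚ) - 1 - i := by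
          rw [Nat.sub_sub, Nat.cast_sub (by omega)]; push_cast; ring
        rw [hc]
        nlinarith [sq_nonneg ((h : ℚ) - 2 * i - 1)]
    _ = ((h : ℚ) ^ 2) ^ h := by rw [Finset.prod_const, Finset.card_range]

/-- `(2q)^h ≤ Π_{i<h}(2q+2i+1)`. -/
lemma prod_shift_ge (q h : ℕ) : (2 * (q : ℚ)) ^ h ≤ ∏ i ∈ range h, (2 * (q : ℚ) + 2 * i + 1) := by
  calc (2 * (q : ℚ)) ^ h = ∏ i ∈ range h, (2 * (q : ℚ)) := by rw [Finset.prod_const, Finset.card_range]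
    _ ≤ ∏ i ∈ range h, (2 * (q : ℚ) + 2 * i + 1) := by
        apply Finset.prod_le_prod (fun i _ => by positivity)
        intro i _
        have : (0 : ℚ) ≤ i := by positivity
        linarith

/-- **The numeric core**: for `5 ≤ h`, `k ≤ 2h+1`, `8k ≤ q`, `16h ≤ q`:
`256^h·(2q+k)²·(h²)^h·q ≤ (q·(2q)^h)²`. -/
lemma numeric_core (h k q : ℕ) (hh : 5 ≤ h) (hk : k ≤ 2 * h + 1) (hq : 8 * k ≤ q) (hq' : 16 * h ≤ q) :
    (256 : ℚ) ^ h * (2 * (q : ℚ) + k) ^ 2 * ((h : ℚ) ^ 2) ^ h * q ≤ ((q : ℚ) * (2 * (q : ℚ)) ^ h) ^ 2 := by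
  obtain ⟨h', rfl⟩ : ∃ h', h = h' + 1 := ⟨h - 1, by omega⟩
  have hq16 : (16 : ℚ) * (h' + 1 : ℕ) ≤ q := by exact_mod_cast hq'
  have hq8 : (8 : ℚ) * k ≤ q := by exact_mod_cast hq
  have hk0 : (0 : ℚ) ≤ k := by positivity
  have hA : ((256 : ℚ) * ((h' + 1 : ℕ) : ℚ) ^ 2) ^ h' ≤ ((q : ℚ) ^ 2) ^ h' := by
    apply pow_le_pow_left₀ (by positivity)
    nlinarith [hq16]
  have hB : (64 : ℚ) * (2 * (q : ℚ) + k) ^ 2 ≤ 289 * (q : ℚ) ^ 2 := by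
    nlinarith [hq8, hk0]
  have hC : (289 : ℚ) * ((h' + 1 : ℕ) : ℚ) ≤ 4 ^ (h' + 2) := by
    have := two_eight_nine_le (h' + 1) (by omega)
    rw [show h' + 1 + 1 = h' + 2 by omega] at this
    exact_mod_cast this
  have hh0 : (0 : ℚ) ≤ ((h' + 1 : ℕ) : ℚ) := by positivity
  have hq0 : (0 : ℚ) ≤ q := by positivity
  have e4 : (4 : ℚ) ^ (h' + 2) = 4 ^ (h' + 1) * 4 := by rw [pow_succ]
  have e16 : ((16 : ℚ) * (h' + 1 : ℕ)) * 4 ^ (h' + 1) = 4 * 4 ^ (h' + 2) * (h' + 1 : ℕ) := by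
    rw [e4]; ring
  calc (256 : ℚ) ^ (h' + 1) * (2 * (q : ℚ) + k) ^ 2 * (((h' + 1 : ℕ) : ℚ) ^ 2) ^ (h' + 1) * q
      = ((256 : ℚ) * ((h' + 1 : ℕ) : ℚ) ^ 2) ^ h' * ((256 * ((h' + 1 : ℕ) : ℚ) ^ 2 * q) * (2 * (q : ℚ) + k) ^ 2) := by
        rw [pow_succ, pow_succ, mul_pow]; ring
    _ ≤ ((q : ℚ) ^ 2) ^ h' * ((256 * ((h' + 1 : ℕ) : ℚ) ^ 2 * q) * (2 * (q : ℚ) + k) ^ 2) := by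
        gcongr
    _ = ((q : ℚ) ^ 2) ^ h' * (4 * ((h' + 1 : ℕ) : ℚ) ^ 2 * q * (64 * (2 * (q : ℚ) + k) ^ 2)) := by ring
    _ ≤ ((q : ℚ) ^ 2) ^ h' * (4 * ((h' + 1 : ℕ) : ℚ) ^ 2 * q * (289 * (q : ℚ) ^ 2)) := by
        gcongr
    _ = ((q : ℚ) ^ 2) ^ h' * (q : ℚ) ^ 3 * (4 * ((289 : ℚ) * ((h' + 1 : ℕ) : ℚ)) * ((h' + 1 : ℕ) : ℚ)) := by ring
    _ ≤ ((q : ℚ) ^ 2) ^ h' * (q : ℚ) ^ 3 * (4 * (4 : ℚ) ^ (h' + 2) * ((h' + 1 : ℕ) : ℚ)) := by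
        gcongr
    _ = ((q : ℚ) ^ 2) ^ h' * (q : ℚ) ^ 3 * (4 : ℚ) ^ (h' + 1) * ((16 : ℚ) * (h' + 1 : ℕ)) := by
        rw [e4]; ring
    _ ≤ ((q : ℚ) ^ 2) ^ h' * (q : ℚ) ^ 3 * (4 : ℚ) ^ (h' + 1) * q := by
        gcongr
    _ = ((q : ℚ) * (2 * (q : ℚ)) ^ (h' + 1)) ^ 2 := by
        rw [mul_pow, mul_pow, ← pow_mul, show (4 : ℚ) = 2 ^ 2 by norm_num, ← pow_mul]
        ring

/-- **The tail is small from `q ≥ 8k`** (`k ≥ 10`): `Σ_{k ≤ i < 2k} C(2k−1,i)·W_i(q,q+1−k) ≤ q/(2q+k)`. -/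
theorem tail_le_of_eight_k (q k : ℕ) (hk : 10 ≤ k) (hq : 8 * k ≤ q) :
    ∑ i ∈ Ico k (2 * k), ((2 * k - 1).choose i : ℚ) * sumW q (q + 1 - k) i ≤ (q : ℚ) / (2 * q + k) := by
  set h := k / 2 with hh
  have h2 : 2 * h ≤ k := Nat.mul_div_le k 2
  have h2' : k ≤ 2 * h + 1 := by omega
  have hh5 : 5 ≤ h := by omega
  set m := q + 1 - k with hm
  have hm1 : m + 1 ≤ q := by omega
  have hmk : k ≤ q + 1 := by omega
  have t1 := tail_le_pow_mul_sumW q m k (by omega)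
  have t2 : sumW q m k ≤ sumW q m (2 * h) := sumW_anti q m h2
  have t3 : (4 : ℚ) ^ (k - 1) ≤ (16 : ℚ) ^ h := by
    rw [show (16 : ℚ) = 4 ^ 2 by norm_num, ← pow_mul]
    exact pow_le_pow_right₀ (by norm_num) (by omega)
  have hW := sumW_pos q m (2 * h)
  have hWk := sumW_pos q m k
  have t4 : ∑ i ∈ Ico k (2 * k), ((2 * k - 1).choose i : ℚ) * sumW q m i ≤ (16 : ℚ) ^ h * sumW q m (2 * h) := by
    calc ∑ i ∈ Ico k (2 * k), ((2 * k - 1).choose i : ℚ) * sumW q m i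
        ≤ (4 : ℚ) ^ (k - 1) * sumW q m k := t1
      _ ≤ (16 : ℚ) ^ h * sumW q m (2 * h) := mul_le_mul t3 t2 hWk.le (by positivity)
  have e := sumW_even_le q m hm1 h
  set P := ∏ i ∈ range h, (2 * (i : ℚ) + 1) with hP
  set Qp := ∏ i ∈ range h, (2 * (q : ℚ) + 2 * i + 1) with hQp
  have hP0 : 0 ≤ P := Finset.prod_nonneg (fun i _ => by positivity)
  have hQp0 : 0 < Qp := Finset.prod_pos (fun i _ => by positivity)
  have hS2 : (sumS q m) ^ 2 ≤ q := by rw [hm]; exact sumS_corner_sq_le q k (by omega) hmk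
  have hS0 := sumS_pos q m
  have hPsq := prod_odd_sq_le h
  have hQpge := prod_shift_ge q h
  have hcore := numeric_core h k q hh5 h2' hq (by omega)
  have hq1 : (0 : ℚ) < q := by
    have : 0 < q := by omega
    exact_mod_cast this
  have hE : (0 : ℚ) < 2 * (q : ℚ) + k := by positivity
  -- the squared comparison: 16^h (2q+k) P S ≤ q Qp
  have key : (16 : ℚ) ^ h * (2 * (q : ℚ) + k) * P * sumS q m ≤ q * Qp := by
    have hB : (0 : ℚ) ≤ (q : ℚ) * Qp := by positivity
    have hsq : ((16 : ℚ) ^ h * (2 * (q : ℚ) + k) * P * sumS q m) ^ 2 ≤ ((q : ℚ) * Qp) ^ 2 := by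
      calc ((16 : ℚ) ^ h * (2 * (q : ℚ) + k) * P * sumS q m) ^ 2
          = ((16 : ℚ) ^ h * (2 * (q : ℚ) + k) * P) ^ 2 * (sumS q m) ^ 2 := by ring
        _ ≤ ((16 : ℚ) ^ h * (2 * (q : ℚ) + k) * P) ^ 2 * q := by gcongr
        _ = (256 : ℚ) ^ h * (2 * (q : ℚ) + k) ^ 2 * P ^ 2 * q := by
            rw [show (256 : ℚ) = 16 ^ 2 by norm_num, ← pow_mul, mul_comm 2 h, pow_mul]; ring
        _ ≤ (256 : ℚ) ^ h * (2 * (q : ℚ) + k) ^ 2 * ((h : ℚ) ^ 2) ^ h * q := by gcongr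
        _ ≤ ((q : ℚ) * (2 * (q : ℚ)) ^ h) ^ 2 := hcore
        _ ≤ ((q : ℚ) * Qp) ^ 2 := by gcongr
    exact (pow_le_pow_iff_left₀ (by positivity) hB two_ne_zero).1 hsq
  have step : (16 : ℚ) ^ h * sumW q m (2 * h) * (2 * (q : ℚ) + k) * Qp ≤ q * Qp := by
    calc (16 : ℚ) ^ h * sumW q m (2 * h) * (2 * (q : ℚ) + k) * Qp
        = (16 : ℚ) ^ h * (2 * (q : ℚ) + k) * (Qp * sumW q m (2 * h)) := by ring
      _ ≤ (16 : ℚ) ^ h * (2 * (q : ℚ) + k) * (P * sumS q m) := by gcongr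
      _ = (16 : ℚ) ^ h * (2 * (q : ℚ) + k) * P * sumS q m := by ring
      _ ≤ q * Qp := key
  have step2 : (16 : ℚ) ^ h * sumW q m (2 * h) * (2 * (q : ℚ) + k) ≤ q := le_of_mul_le_mul_right step hQp0
  have step3 : (16 : ℚ) ^ h * sumW q m (2 * h) ≤ (q : ℚ) / (2 * q + k) := by
    rw [le_div_iff₀ hE]; exact step2
  exact t4.trans step3

/-- **THE CORNER OF EVERY FAMILY `k ≥ 10` FOR EVERY `q ≥ 8k`**: `Φ(q+k, q) ≤ R̂(q, k, q+1−k)`. -/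
theorem rhat_corner_of_eight_k (q k : ℕ) (hk : 10 ≤ k) (hq : 8 * k ≤ q) :
    phiK (q + k) q ≤ rhat q k (q + 1 - k) :=
  rhat_corner_of_tail q k (by omega) (by omega) (tail_le_of_eight_k q k hk hq)

end PercRepro
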